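import Literature.MathematicalPhysics.QuantumFieldTheory.Balaban1983to89.B9Eq324DeltaPrimeATower
import Literature.MathematicalPhysics.QuantumFieldTheory.Balaban1983to89.B9Eq319QprimeContraction

/-!
# `Balaban1983to89.B9Eq324PenaltyPointwiseBound` — T. Bałaban, *Propagators for lattice gauge theories in a background field*, Commun. Math. Phys.
# **99** (1985) 389–434 [Balaban1985BackgroundPropagators] (3.24) p. 394 with (3.19) p. 393, (3.11) p. 392 and Thm 3.1 (3.42) p. 397: **THE
# AVERAGING PENALTY `a′Q′(U)†Q′(U)` OF `Δ′_{a′}(U) = Δ^η_U + a′Q′(U)†Q′(U)` IS BOUNDED `L² → L^∞` LEVEL-FREE —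
# `‖((Δ′_{a′}(U) − Δ^η_U)v)(x)‖ ≤ |a′|·(c₁∕(c₀L^d))·(c₀L^d)^{−1∕2}·‖v‖_{L²(c₀)}` AT EVERY SITE, FOR EVERY BACKGROUND WITH CONTRACTIVE
# TRANSPORTERS, one step (`B9Eq3119DeltaPiCarrier.laplacePrimeA`) and `k = n+1` levels (`B9Eq324DeltaPrimeATower.laplacePrimeAk`, `L^{n+1}` for
# `L`); `= |a′|∕√c₁` on the diagonal `c₀(L^k)^d = c₁`** — the PENALTY LETTER (P) (binder `hP`) of the pub-balaban NE9 owner's sup-norm bootstrap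
# for the VALUE row of (3.42) (`B9Eq342GreenPrimeSupBound.norm_GpOfU_apply_le` ∕ `B9Eq342GreenPrimeTowerSupBound.norm_GpOfUk_apply_le`,
# plan v10 `t4/b2b-balaban-t4-ne9-p1/g89/SUP-NORM-PROGRAMME.md` §3 (iii)), INHABITED

statement-level skeleton of published theorems with citation tags; proofs where landed; nothing here is a claim about the Yang–Mills mass gap

CITATION HEADER (lean-in-tree rule).  Audit cell `pub-balaban`, sub-cell `t4`, BINDER row NE9; filed by NE9 formalisation-swarm LEAF PROVER 03
(`b2b-balaban-t4-ne9-formalise-leaf-03`, gen 69), INTENT I-ne9leaf03-g69-P (second half), composing BY NAME: `B9Eq311L2Pairing.WL2` (the weighted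
`L²` carrier (3.11), `inner_def`, `norm_sq`), `B9Eq326OperatorAssembly.QprimeW` ∕ `B9Eq326OperatorTower.QprimeTowerW` ((3.19), one step ∕ composite),
`B9Eq3119DeltaPiCarrier.laplacePrimeA` ∕ `B9Eq324DeltaPrimeATower.laplacePrimeAk` ((3.24)), `B11Eq103H1Complex.covLaplaceSiteK` ((3.23)), this
lineage's `B9Eq319QprimeContraction` (the scaled `ℓ¹`∕`ℓ²` contractions of `Q′(R)`, `Q′_k(R)`), Mathlib's `LinearMap.adjoint`.  Sources READ
first-hand by this seat in the held text layer `paper:balaban1985-cmp99-background-propagators` (journal page = PDF page + 388): p. 392 (3.11); p. 393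
(3.19) `(Q′(U)λ)(y) = Σ_{x∈B^j(y)} L^{−d}R(U(Γ^y_x))λ(x)` and *«The norm ‖ ‖ in (3.17) is determined by the scalar product ⟨λ, λ′⟩ = Σ_{x∈Ω₀} η^d tr
λ(x)λ′(x)»*; p. 394 *«Let us introduce the operator Δ′_a = Δ′_a(U) = (Δ^η_U + Q′*aQ′)|Ω₀, where Q′*aQ′ is defined by the same quadratic form as in
(2.14), i.e. ⟨λ, Q′*aQ′λ⟩ = Σ_j a_j Σ_{y∈Λ_j} (L^jη)^{d−2}|(Q′_j(U)λ)(y)|²»* (3.24) (the cell types ONE term of this sum with the weight letter `c₁` and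
the constant `a′`); p. 397 (3.39) *«Thus we have the supremum norms |λ| = max sup|λ_μ(x)|»* and Thm 3.1 *«… the operator G′(U) (a = 1) satisfies the
inequalities |(G′(U)λ)(x)|, … ≤ B₀ … for x ∈ Δ(y), y ∈ Λ_j, supp λ ⊂ Δ(y′); (3.42)»*.  NOTHING of print's random-walk proof of Thm 3.1 is reproduced;
this file inhabits ONE displayed letter of the cell's substitute (positivity) route.

WHY THIS FILE (cell context; the owner's DIAGNOSIS D-ne9p1-g89-1).  A level-free sup-norm row needs every letter free of the `η^{−d∕2} = c₀^{−1∕2}` an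
`L² → sup` passage costs.  The penalty is the one non-Kato term of `Δ′_{a′}(U)`; its sup size is level-free because the ADJOINT of an AVERAGE over a
block of `L^d` sites (weights `c₀` fine, `c₁` coarse) is a SPREAD — `(Q̃′†h)(x) = (c₁∕(c₀L^d))·R†h(y(x))` — read pointwise at no cost (§0's duality),
while `Q̃′` itself is `L²`-bounded by `√(c₁∕(c₀L^d))` (Jensen).  On the diagonal both factors are `1` up to `1∕√c₁`.

WHAT IS PROVED (sorry-free; proof lane — no `def`; [folklore] finite-dimensional duality + block bookkeeping BY NAME).
* §0 (any weighted carrier `WL2 𝕜 w V`) `inner_single_left` (`⟪δ_x u, g⟫ = w(x)⟪u, g(x)⟫`), (private `sum_norm_single_apply`), **`norm_adjoint_apply_le`**: for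
  `A : WL2 𝕜 w V →ₗ H` with `‖A(δ_x u)‖ ≤ κ‖u‖`: `‖(A†h)(x)‖ ≤ (κ∕w(x))·‖h‖`.
* §1 ONE STEP, `hR : ‖R(U(b))w‖ ≤ ‖w‖`: **`norm_Qtilde_le`** (`‖Q̃′(U)v‖_{c₁} ≤ √(c₁∕(c₀L^d))·‖v‖_{c₀}` — the flat `norm_Qtilde_flat_le` ∕
  `norm_Qtilde_one_le` of the tree for every contractive `U`), **`norm_Qtilde_single_le`** (`‖Q̃′(U)(δ_x u)‖_{c₁} ≤ √c₁·L^{−d}·‖u‖`, sharp),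
  `laplacePrimeA_sub_covLaplace_eq` (`Δ′_{a′}(U) − Δ^η_U = a′Q̃′†Q̃′`, definitional), **`norm_adjoint_Qtilde_apply_le`**
  (`‖(Q̃′(U)†h)(x)‖ ≤ (√c₁∕(c₀L^d))·‖h‖_{c₁}`), **`norm_laplacePrimeA_sub_covLaplace_apply_le`** — THE LETTER (P), literally the binder `hP` of
  `norm_GpOfU_apply_le` at `p₂ := |a′|·(c₁∕(c₀L^d))·(√(c₀L^d))⁻¹`; **`…_diagonal`** (`c₁ = L^d c₀`): `p₂ = |a′|∕√c₁`.
* §2 `k = n+1` LEVELS, `hRlev : ‖R(Ū^j(b))w‖ ≤ ‖w‖` for every level `j`: the verbatim twins **`norm_QtildeTower_le`**, **`norm_QtildeTower_single_le`**,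
  `laplacePrimeAk_sub_covLaplace_eq`, **`norm_adjoint_QtildeTower_apply_le`**, **`norm_laplacePrimeAk_sub_covLaplace_apply_le`** (the binder `hP` of
  `norm_GpOfUk_apply_le` at `p₂ := |a′|·(c₁∕(c₀(L^{n+1})^d))·(√(c₀(L^{n+1})^d))⁻¹`), **`…_diagonal`** (`c₀(L^{n+1})^d = c₁`): `p₂ = |a′|∕√c₁` for EVERY
  `n` — LEVEL-FREE; with the one-block mass `√μ = √c₁` of the bootstrap, `p₂√μ = |a′|`.
MODEL ∕ DECLARED READINGS.  (M1)–(M4) as `B9Eq3119DeltaPiCarrier` ∕ `B9Eq324DeltaPrimeATower` (periodic lattices, fibre `W ≃ 𝔸`, weights `c₀`, `c₁`,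
transporters `adTransportW`); (M5) CONTRACTION `hR` ∕ `hRlev` is the only letter — print's unitary backgrounds on the trace-normed fibre (the owner's
`B9Eq342GreenPrimeSupBound.norm_adTransportW_eq`; the levels `Ū^j` unitary by `B9Eq326OperatorTowerRealityUnitary.UlevOf_star_eq_inv`), displayed,
not asserted; NO small-field window, NO `M_φ`, NO volume enters.
HONEST SCOPE.  ONE displayed letter of the owner's substitute route for the VALUE row of (3.42) inhabited — NOT Thm 3.1, no decay in `d(y,y′)`, no
∇-row; NOT NE9 (cell pub-balaban: NE9 NOT PRINTED ∕ NOT PROVED; «NE9 ⇐ the named binders»; row WALLED ON A MODEL (O-NE9-1; #5 UNRULED); spine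
PROVED 0∕9; rung (B)+1 on a finite T⁴ — NOT infinite volume, NOT mass gap, NOT BetaPertH, NOT Clay; HONEST DEPENDENCY: continuum YM on T⁴ ⇐ BetaPertH
∧ nine spine estimates (0/9 proved); BetaPertH ⇐ (D1) ∧ (D4) ∧ CAP+tail; G-an2-4 gates asym, D1 and NE2/3/4).  NEW file importing
`B9Eq324DeltaPrimeATower` and `B9Eq319QprimeContraction`; nothing modified.  Net new unproved facts: 0.
-/

noncomputable section

open scoped InnerProductSpace ComplexConjugate BigOperators

namespace Literature.MathematicalPhysics.QuantumFieldTheory.Balaban1983to89.B9Eq324PenaltyPointwiseBound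

open B4Sect5Torus (TSite)
open B9SectCLatticeCarrier (Bond)
open B9Eq311L2Pairing (WL2)
open B9Eq319QprimeTorus (fineP QprimeLin)
open B9Eq319QprimeContraction (sum_norm_QprimeLin_le sum_norm_sq_QprimeLin_le sum_norm_QprimeTower_le sum_norm_sq_QprimeTower_le)
open B9Eq315QTower (towerP QprimeTower UlevOf)
open B11Eq103H1Complex (SiteL2K covLaplaceSiteK)
open B9Eq310HessianOperator (adTransportW)
open B9Eq326OperatorAssembly (QprimeW)
open B9Eq326OperatorTower (QprimeTowerW)
open B9Eq3119DeltaPiCarrier (laplacePrimeA)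
open B9Eq324DeltaPrimeATower (laplacePrimeAk)

/-! ## §0 Duality on the weighted `L²` carrier: the sup size of an adjoint is the `L²` size of the map on one-site functions -/

section Duality

variable {X : Type*} [Fintype X] [DecidableEq X] {𝕜 : Type*} [RCLike 𝕜] {w : X → ℝ} [Fact (∀ x, 0 < w x)]
  {V : Type*} [NormedAddCommGroup V] [InnerProductSpace 𝕜 V]

/-- **THE ONE-SITE FUNCTION PAIRS BY ITS WEIGHT**: `⟪δ_x u, g⟫ = w(x)·⟪u, g(x)⟫` for `δ_x u :=` the function `u` at `x`, `0` elsewhere, read in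
the weighted `L²` carrier (3.11). [cite: Balaban1985BackgroundPropagators, (3.11) p.392] -/
theorem inner_single_left (x : X) (u : V) (g : WL2 𝕜 w V) :
    ⟪(WL2.equiv 𝕜 w V).symm (Pi.single x u), g⟫_𝕜 = (w x : 𝕜) * ⟪u, WL2.equiv 𝕜 w V g x⟫_𝕜 := by
  rw [WL2.inner_def, Finset.sum_eq_single x]
  · rw [Equiv.apply_symm_apply, Pi.single_eq_same]
  · intro y _ hy
    rw [Equiv.apply_symm_apply, Pi.single_eq_of_ne hy, inner_zero_left, mul_zero]
  · intro h
    exact absurd (Finset.mem_univ x) h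

/-- The values of the one-site function: `Σ_{x′} ‖(δ_x u)(x′)‖ = ‖u‖`. [folklore] -/
private theorem sum_norm_single_apply (x : X) (u : V) : ∑ x', ‖(Pi.single x u : X → V) x'‖ = ‖u‖ := by
  rw [Finset.sum_eq_single x]
  · rw [Pi.single_eq_same]
  · intro y _ hy
    rw [Pi.single_eq_of_ne hy, norm_zero]
  · intro h
    exact absurd (Finset.mem_univ x) h

variable [FiniteDimensional 𝕜 V] {H : Type*} [NormedAddCommGroup H] [InnerProductSpace 𝕜 H] [FiniteDimensional 𝕜 H]

/-- **DUALITY — THE POINTWISE SIZE OF AN ADJOINT.**  For a linear `A` from the weighted `L²` carrier into any finite-dimensional inner-product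
space with `‖A(δ_x u)‖ ≤ κ‖u‖` on the one-site functions at `x` (`κ ≥ 0`): `‖(A†h)(x)‖ ≤ (κ∕w(x))·‖h‖` — at `u := (A†h)(x)`,
`w(x)‖u‖² = re⟪δ_x u, A†h⟫ = re⟪A(δ_x u), h⟫ ≤ κ‖u‖‖h‖`.  NO `w(x)^{−1∕2}`: the `L² → sup` size of an ADJOINT is the `fibre → L²` size of the map
on ONE site (for an average: the adjoint is a spread). [folklore] [cite: Balaban1985BackgroundPropagators, (3.11) p.392, (3.24) p.394] -/
theorem norm_adjoint_apply_le (A : WL2 𝕜 w V →ₗ[𝕜] H) (x : X) {κ : ℝ} (hκ : 0 ≤ κ)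
    (hA : ∀ u : V, ‖A ((WL2.equiv 𝕜 w V).symm (Pi.single x u))‖ ≤ κ * ‖u‖) (h : H) :
    ‖WL2.equiv 𝕜 w V (LinearMap.adjoint A h) x‖ ≤ κ / w x * ‖h‖ := by
  have hw : 0 < w x := (Fact.out : ∀ x, 0 < w x) x
  rw [div_mul_eq_mul_div, le_div_iff₀ hw, mul_comm]
  set u : V := WL2.equiv 𝕜 w V (LinearMap.adjoint A h) x with hu
  have h1 : w x * ‖u‖ ^ 2 = RCLike.re ⟪A ((WL2.equiv 𝕜 w V).symm (Pi.single x u)), h⟫_𝕜 := by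
    rw [← LinearMap.adjoint_inner_right, inner_single_left, ← hu, RCLike.re_ofReal_mul, inner_self_eq_norm_sq]
  have h2 : w x * ‖u‖ * ‖u‖ ≤ κ * ‖h‖ * ‖u‖ := by
    calc w x * ‖u‖ * ‖u‖ = w x * ‖u‖ ^ 2 := by ring
      _ ≤ ‖A ((WL2.equiv 𝕜 w V).symm (Pi.single x u))‖ * ‖h‖ := by rw [h1]; exact re_inner_le_norm _ _
      _ ≤ κ * ‖u‖ * ‖h‖ := mul_le_mul_of_nonneg_right (hA u) (norm_nonneg _)
      _ = κ * ‖h‖ * ‖u‖ := by ring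
  by_cases hu0 : u = 0
  · rw [hu0, norm_zero, mul_zero]
    positivity
  · exact le_of_mul_le_mul_right h2 (norm_pos_iff.2 hu0)

/-- The constant of the penalty letter: `(√c₁·M⁻¹∕c₀)·√(c₁∕(c₀M)) = (c₁∕(c₀M))·(√(c₀M))⁻¹` (`M = L^d` or `(L^{n+1})^d`). [folklore] -/
private theorem penalty_const_eq {c₀ c₁ M : ℝ} (hc₀ : 0 < c₀) (hc₁ : 0 < c₁) (hM : 0 < M) :
    Real.sqrt c₁ * M⁻¹ / c₀ * Real.sqrt (c₁ / (c₀ * M)) = c₁ / (c₀ * M) * (Real.sqrt (c₀ * M))⁻¹ := by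
  rw [Real.sqrt_div hc₁.le, show Real.sqrt c₁ * M⁻¹ / c₀ * (Real.sqrt c₁ / Real.sqrt (c₀ * M)) =
      (Real.sqrt c₁ * Real.sqrt c₁) * (M⁻¹ / c₀) * (Real.sqrt (c₀ * M))⁻¹ by ring, Real.mul_self_sqrt hc₁.le]
  have hc₀' : c₀ ≠ 0 := hc₀.ne'
  have hM' : M ≠ 0 := hM.ne'
  field_simp

end Duality

/-! ## §1 The chain's `Q̃′(U)` (one step) for CONTRACTIVE transporters, and the penalty letter (P) of `Δ′_{a′}(U)` -/

section ChainOneStep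

variable {d : ℕ} (L : ℕ) [NeZero L] (m : Fin d → ℕ) {𝔸 : Type*} [Ring 𝔸] [Algebra ℂ 𝔸]
  {W : Type*} [NormedAddCommGroup W] [InnerProductSpace ℂ W] (φ : W ≃ₗ[ℂ] 𝔸) {c₀ : ℝ} [Fact (0 < c₀)] {c₁ : ℝ} [Fact (0 < c₁)]
  (U : Bond d (fineP L m) → 𝔸ˣ) (hR : ∀ b w, ‖adTransportW φ U b w‖ ≤ ‖w‖)
include hR

/-- **`‖Q̃′(U)v‖_{c₁} ≤ √(c₁∕(c₀L^d))·‖v‖_{c₀}` FOR EVERY BACKGROUND WITH CONTRACTIVE TRANSPORTERS** (`Q̃′(U)` = `Q′(U)` of (3.19) read into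
the weight-`c₁` space of the unit lattice, as inside `laplacePrimeA`) — the flat `B9Thm311SitePrimeFormCoerciveCanonical.norm_Qtilde_flat_le` ∕
`B9Eq325RLipschitzResolvent.norm_Qtilde_one_le` with `1` replaced by any such `U`; `= ‖v‖` on the diagonal `c₁ = L^d c₀`.
[cite: Balaban1985BackgroundPropagators, (3.19) p.393, (3.24) p.394, (3.11) p.392; Balaban1985Averaging, (2)–(4) pp.17–18] -/
theorem norm_Qtilde_le (v : SiteL2K ℂ d (fineP L m) c₀ W) :
    ‖((WL2.linearEquiv ℂ ℂ (fun _ : TSite d m => c₁)).symm.toLinearMap ∘ₗ QprimeW L m φ U) v‖ ≤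
      Real.sqrt (c₁ / (c₀ * (L : ℝ) ^ d)) * ‖v‖ := by
  have hc₀ : 0 < c₀ := Fact.out
  have hc₁ : 0 < c₁ := Fact.out
  have hLr : (0 : ℝ) < (L : ℝ) ^ d := pow_pos (by exact_mod_cast Nat.pos_of_ne_zero (NeZero.ne L)) d
  refine (pow_le_pow_iff_left₀ (norm_nonneg _) (by positivity) two_ne_zero).1 ?_
  set g : TSite d (fineP L m) → W := WL2.equiv ℂ (fun _ : TSite d (fineP L m) => c₀) W v with hg
  have hsq : ‖((WL2.linearEquiv ℂ ℂ (fun _ : TSite d m => c₁)).symm.toLinearMap ∘ₗ QprimeW L m φ U) v‖ ^ 2 =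
      c₁ * ∑ y, ‖QprimeLin L m (adTransportW φ U) g y‖ ^ 2 := by
    rw [WL2.norm_sq (𝕜 := ℂ) (w := fun _ : TSite d m => c₁) (V := W), Finset.mul_sum]
    refine Finset.sum_congr rfl fun y _ => ?_
    simp only [LinearMap.comp_apply, LinearEquiv.coe_coe, WL2.linearEquiv_symm_apply, Equiv.apply_symm_apply]
    rfl
  have hv : ‖v‖ ^ 2 = c₀ * ∑ x, ‖g x‖ ^ 2 := by
    rw [WL2.norm_sq (𝕜 := ℂ) (w := fun _ : TSite d (fineP L m) => c₀) (V := W), Finset.mul_sum]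
  rw [hsq, mul_pow, Real.sq_sqrt (by positivity)]
  have h := sum_norm_sq_QprimeLin_le L m (adTransportW φ U) hR g
  calc c₁ * ∑ y, ‖QprimeLin L m (adTransportW φ U) g y‖ ^ 2 ≤ c₁ * (((L : ℝ) ^ d)⁻¹ * ∑ x, ‖g x‖ ^ 2) :=
        mul_le_mul_of_nonneg_left h hc₁.le
    _ = c₁ / (c₀ * (L : ℝ) ^ d) * ‖v‖ ^ 2 := by rw [hv]; field_simp

omit [Fact (0 < c₀)] in
/-- **THE ONE-SITE IMAGE, SHARP: `‖Q̃′(U)(δ_x u)‖_{c₁} ≤ √c₁·L^{−d}·‖u‖`** — `δ_x u` is seen by ONE block with weight `L^{−d}` and a contraction: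
`Σ_y ‖(Q′δ)(y)‖² ≤ (Σ_y ‖(Q′δ)(y)‖)² ≤ (L^{−d}Σ_{x′}‖δ(x′)‖)² = (L^{−d}‖u‖)²` (the `ℓ¹` form of `B9Eq319QprimeContraction`, NOT Jensen, which would cost `√(L^d)`).
[cite: Balaban1985BackgroundPropagators, (3.19) p.393, (3.11) p.392] -/
theorem norm_Qtilde_single_le (x : TSite d (fineP L m)) (u : W) :
    ‖((WL2.linearEquiv ℂ ℂ (fun _ : TSite d m => c₁)).symm.toLinearMap ∘ₗ QprimeW L m φ U)
        ((WL2.equiv ℂ (fun _ : TSite d (fineP L m) => c₀) W).symm (Pi.single x u))‖ ≤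
      Real.sqrt c₁ * ((L : ℝ) ^ d)⁻¹ * ‖u‖ := by
  have hc₁ : 0 < c₁ := Fact.out
  have hLr : (0 : ℝ) < (L : ℝ) ^ d := pow_pos (by exact_mod_cast Nat.pos_of_ne_zero (NeZero.ne L)) d
  refine (pow_le_pow_iff_left₀ (norm_nonneg _) (by positivity) two_ne_zero).1 ?_
  have hsq : ‖((WL2.linearEquiv ℂ ℂ (fun _ : TSite d m => c₁)).symm.toLinearMap ∘ₗ QprimeW L m φ U)
        ((WL2.equiv ℂ (fun _ : TSite d (fineP L m) => c₀) W).symm (Pi.single x u))‖ ^ 2 =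
      c₁ * ∑ y, ‖QprimeLin L m (adTransportW φ U) (Pi.single x u) y‖ ^ 2 := by
    rw [WL2.norm_sq (𝕜 := ℂ) (w := fun _ : TSite d m => c₁) (V := W), Finset.mul_sum]
    refine Finset.sum_congr rfl fun y _ => ?_
    simp only [LinearMap.comp_apply, LinearEquiv.coe_coe, WL2.linearEquiv_symm_apply, Equiv.apply_symm_apply]
    rfl
  rw [hsq, mul_assoc, mul_pow, Real.sq_sqrt hc₁.le]
  refine mul_le_mul_of_nonneg_left ?_ hc₁.le
  have h1 : ∑ y, ‖QprimeLin L m (adTransportW φ U) (Pi.single x u) y‖ ^ 2 ≤ (∑ y, ‖QprimeLin L m (adTransportW φ U) (Pi.single x u) y‖) ^ 2 :=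
    Finset.sum_sq_le_sq_sum_of_nonneg fun y _ => norm_nonneg _
  have h2 : ∑ y, ‖QprimeLin L m (adTransportW φ U) (Pi.single x u) y‖ ≤ ((L : ℝ) ^ d)⁻¹ * ‖u‖ := by
    have h := sum_norm_QprimeLin_le L m (adTransportW φ U) hR (Pi.single x u)
    rwa [sum_norm_single_apply] at h
  calc ∑ y, ‖QprimeLin L m (adTransportW φ U) (Pi.single x u) y‖ ^ 2
      ≤ (∑ y, ‖QprimeLin L m (adTransportW φ U) (Pi.single x u) y‖) ^ 2 := h1
    _ ≤ (((L : ℝ) ^ d)⁻¹ * ‖u‖) ^ 2 := pow_le_pow_left₀ (Finset.sum_nonneg fun y _ => norm_nonneg _) h2 2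

omit hR in
/-- The penalty of (3.24) IS `a′·Q̃′(U)†Q̃′(U)`: `Δ′_{a′}(U)v − Δ^η_U v = a′·Q̃′(U)†(Q̃′(U)v)` (definitional bookkeeping on `laplacePrimeA`).
[cite: Balaban1985BackgroundPropagators, (3.24) p.394] -/
theorem laplacePrimeA_sub_covLaplace_eq (η a' : ℝ) (v : SiteL2K ℂ d (fineP L m) c₀ W) [FiniteDimensional ℂ W] :
    laplacePrimeA L m φ η U a' (c₁ := c₁) v -
        covLaplaceSiteK ((η : ℂ))⁻¹ (adTransportW φ U) (adTransportW φ fun b => (U b)⁻¹) v =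
      (a' : ℂ) • LinearMap.adjoint ((WL2.linearEquiv ℂ ℂ (fun _ : TSite d m => c₁)).symm.toLinearMap ∘ₗ QprimeW L m φ U)
        (((WL2.linearEquiv ℂ ℂ (fun _ : TSite d m => c₁)).symm.toLinearMap ∘ₗ QprimeW L m φ U) v) := by
  simp only [laplacePrimeA, LinearMap.add_apply, LinearMap.smul_apply, LinearMap.comp_apply, add_sub_cancel_left]

variable [FiniteDimensional ℂ W]

/-- **THE ADJOINT `Q̃′(U)†` POINTWISE: `‖(Q̃′(U)†h)(x)‖ ≤ (√c₁∕(c₀L^d))·‖h‖_{c₁}`** at every fine site — §0's duality at the one-site image above;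
on the diagonal `c₁ = L^d c₀` the constant is `1∕√c₁` (the adjoint of an AVERAGE is a SPREAD: `(Q̃′†h)(x) = (c₁∕(c₀L^d))·R†h(y(x))`, read at no
`c₀^{−1∕2}` cost). [cite: Balaban1985BackgroundPropagators, (3.19) p.393, (3.24) p.394, (3.11) p.392] -/
theorem norm_adjoint_Qtilde_apply_le (h : SiteL2K ℂ d m c₁ W) (x : TSite d (fineP L m)) :
    ‖WL2.equiv ℂ (fun _ : TSite d (fineP L m) => c₀) W
        (LinearMap.adjoint ((WL2.linearEquiv ℂ ℂ (fun _ : TSite d m => c₁)).symm.toLinearMap ∘ₗ QprimeW L m φ U) h) x‖ ≤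
      Real.sqrt c₁ * ((L : ℝ) ^ d)⁻¹ / c₀ * ‖h‖ :=
  norm_adjoint_apply_le (𝕜 := ℂ) (w := fun _ : TSite d (fineP L m) => c₀) _ x (by positivity) (fun u => norm_Qtilde_single_le L m φ U hR x u) h

/-- **THE PENALTY LETTER (P) OF THE SUP-NORM BOOTSTRAP, INHABITED FOR EVERY BACKGROUND WITH CONTRACTIVE TRANSPORTERS**:
`‖((Δ′_{a′}(U) − Δ^η_U)v)(x)‖ = ‖(a′Q̃′(U)†Q̃′(U)v)(x)‖ ≤ |a′|·(c₁∕(c₀L^d))·(c₀L^d)^{−1∕2}·‖v‖_{c₀}` at every fine site — LITERALLY the binder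
`hP` of the NE9 owner's `B9Eq342GreenPrimeSupBound.norm_GpOfU_apply_le` at `p₂ := |a′|·(c₁∕(c₀L^d))·(√(c₀L^d))⁻¹`; NO `η`, NO volume, NO `M_φ`,
no window. [cite: Balaban1985BackgroundPropagators, (3.24) p.394, Thm 3.1 (3.42) p.397] -/
theorem norm_laplacePrimeA_sub_covLaplace_apply_le (η a' : ℝ) (v : SiteL2K ℂ d (fineP L m) c₀ W) (x : TSite d (fineP L m)) :
    ‖WL2.equiv ℂ _ W (laplacePrimeA L m φ η U a' (c₁ := c₁) v -
        covLaplaceSiteK ((η : ℂ))⁻¹ (adTransportW φ U) (adTransportW φ fun b => (U b)⁻¹) v) x‖ ≤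
      |a'| * (c₁ / (c₀ * (L : ℝ) ^ d)) * (Real.sqrt (c₀ * (L : ℝ) ^ d))⁻¹ * ‖v‖ := by
  have hc₀ : 0 < c₀ := Fact.out
  have hc₁ : 0 < c₁ := Fact.out
  have hLr : (0 : ℝ) < (L : ℝ) ^ d := pow_pos (by exact_mod_cast Nat.pos_of_ne_zero (NeZero.ne L)) d
  rw [laplacePrimeA_sub_covLaplace_eq L m φ U (c₁ := c₁) η a' v, WL2.equiv_smul, Pi.smul_apply, norm_smul, Complex.norm_real,
    Real.norm_eq_abs]
  have h1 := norm_adjoint_Qtilde_apply_le L m φ (c₀ := c₀) U hR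
    (((WL2.linearEquiv ℂ ℂ (fun _ : TSite d m => c₁)).symm.toLinearMap ∘ₗ QprimeW L m φ U) v) x
  have h3 := h1.trans (mul_le_mul_of_nonneg_left (norm_Qtilde_le L m φ U hR (c₁ := c₁) v) (by positivity))
  refine (mul_le_mul_of_nonneg_left h3 (abs_nonneg _)).trans (le_of_eq ?_)
  rw [← mul_assoc (Real.sqrt c₁ * _ / c₀), penalty_const_eq hc₀ hc₁ hLr]
  ring

/-- **(P) ON THE DIAGONAL `c₁ = L^d c₀`** (`ηL = 1`, `c₀ = η^d`): `p₂ = |a′|∕√c₁` — and `p₂·√μ = |a′|` at the one-block mass `μ = c₁`.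
[cite: Balaban1985BackgroundPropagators, (3.24) p.394, Thm 3.1 (3.42) p.397] -/
theorem norm_laplacePrimeA_sub_covLaplace_apply_le_diagonal (hc : c₁ = (L : ℝ) ^ d * c₀) (η a' : ℝ)
    (v : SiteL2K ℂ d (fineP L m) c₀ W) (x : TSite d (fineP L m)) :
    ‖WL2.equiv ℂ _ W (laplacePrimeA L m φ η U a' (c₁ := c₁) v -
        covLaplaceSiteK ((η : ℂ))⁻¹ (adTransportW φ U) (adTransportW φ fun b => (U b)⁻¹) v) x‖ ≤
      |a'| * (Real.sqrt c₁)⁻¹ * ‖v‖ := by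
  have hc₀ : 0 < c₀ := Fact.out
  have hLr : (0 : ℝ) < (L : ℝ) ^ d := pow_pos (by exact_mod_cast Nat.pos_of_ne_zero (NeZero.ne L)) d
  have h := norm_laplacePrimeA_sub_covLaplace_apply_le L m φ U hR (c₁ := c₁) η a' v x
  have h1 : c₁ / (c₀ * (L : ℝ) ^ d) = 1 := by rw [hc, mul_comm]; exact div_self (by positivity)
  have h2 : c₀ * (L : ℝ) ^ d = c₁ := by rw [hc, mul_comm]
  rwa [h1, mul_one, h2] at h

end ChainOneStep

/-! ## §2 The tower twin: `Q̃′_k(U)` (`k = n+1` levels) and the penalty letter of `Δ′_{a′,k}(U)` -/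

section ChainTower

variable {d : ℕ} (L : ℕ) [NeZero L] (m : Fin d → ℕ) [∀ i, NeZero (m i)] (n : ℕ)
  {𝔸 : Type*} [NormedRing 𝔸] [NormedAlgebra ℂ 𝔸] [CompleteSpace 𝔸]
  {W : Type*} [NormedAddCommGroup W] [InnerProductSpace ℂ W] (φ : W ≃ₗ[ℂ] 𝔸) {c₀ : ℝ} [Fact (0 < c₀)] {c₁ : ℝ} [Fact (0 < c₁)]
  (U : Bond d (towerP L m (n + 1)) → 𝔸ˣ) (hRlev : ∀ j b w, ‖adTransportW φ (UlevOf L m (n + 1) U j) b w‖ ≤ ‖w‖)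
include hRlev

/-- **`‖Q̃′_k(U)v‖_{c₁} ≤ √(c₁∕(c₀(L^{n+1})^d))·‖v‖_{c₀}` FOR CONTRACTIVE LEVEL TRANSPORTERS** (`Q̃′_k(U)` = print's composite `Q′_{n+1}(U)`,
`B9Eq326OperatorTower.QprimeTowerW`, read into the weight-`c₁` space, as inside `laplacePrimeAk`) — the flat
`B9Eq319QprimeTowerLipschitzL2.norm_QtildeTower_one_le` for every such tower; `= ‖v‖` on the diagonal `c₀(L^{n+1})^d = c₁`.
[cite: Balaban1985BackgroundPropagators, (3.19) p.393, (3.24) p.394, (3.11) p.392; Balaban1985Averaging, (2)–(4) pp.17–18] -/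
theorem norm_QtildeTower_le (v : SiteL2K ℂ d (towerP L m (n + 1)) c₀ W) :
    ‖((WL2.linearEquiv ℂ ℂ (fun _ : TSite d m => c₁)).symm.toLinearMap ∘ₗ QprimeTowerW L m n φ U) v‖ ≤
      Real.sqrt (c₁ / (c₀ * ((L : ℝ) ^ (n + 1)) ^ d)) * ‖v‖ := by
  have hc₀ : 0 < c₀ := Fact.out
  have hc₁ : 0 < c₁ := Fact.out
  have hLr : (0 : ℝ) < ((L : ℝ) ^ (n + 1)) ^ d := pow_pos (pow_pos (by exact_mod_cast Nat.pos_of_ne_zero (NeZero.ne L)) _) d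
  refine (pow_le_pow_iff_left₀ (norm_nonneg _) (by positivity) two_ne_zero).1 ?_
  set g : TSite d (towerP L m (n + 1)) → W := WL2.equiv ℂ (fun _ : TSite d (towerP L m (n + 1)) => c₀) W v with hg
  have hsq : ‖((WL2.linearEquiv ℂ ℂ (fun _ : TSite d m => c₁)).symm.toLinearMap ∘ₗ QprimeTowerW L m n φ U) v‖ ^ 2 =
      c₁ * ∑ y, ‖QprimeTower L m (fun j => adTransportW φ (UlevOf L m (n + 1) U j)) (n + 1) g y‖ ^ 2 := by
    rw [WL2.norm_sq (𝕜 := ℂ) (w := fun _ : TSite d m => c₁) (V := W), Finset.mul_sum]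
    refine Finset.sum_congr rfl fun y _ => ?_
    simp only [LinearMap.comp_apply, LinearEquiv.coe_coe, WL2.linearEquiv_symm_apply, Equiv.apply_symm_apply]
    rfl
  have hv : ‖v‖ ^ 2 = c₀ * ∑ x, ‖g x‖ ^ 2 := by
    rw [WL2.norm_sq (𝕜 := ℂ) (w := fun _ : TSite d (towerP L m (n + 1)) => c₀) (V := W), Finset.mul_sum]
  rw [hsq, mul_pow, Real.sq_sqrt (by positivity)]
  have h := sum_norm_sq_QprimeTower_le L m (fun j => adTransportW φ (UlevOf L m (n + 1) U j)) hRlev (n + 1) g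
  calc c₁ * ∑ y, ‖QprimeTower L m (fun j => adTransportW φ (UlevOf L m (n + 1) U j)) (n + 1) g y‖ ^ 2
      ≤ c₁ * ((((L : ℝ) ^ (n + 1)) ^ d)⁻¹ * ∑ x, ‖g x‖ ^ 2) := mul_le_mul_of_nonneg_left h hc₁.le
    _ = c₁ / (c₀ * ((L : ℝ) ^ (n + 1)) ^ d) * ‖v‖ ^ 2 := by rw [hv]; field_simp

omit [Fact (0 < c₀)] in
/-- **THE ONE-SITE IMAGE UNDER THE COMPOSITE, SHARP: `‖Q̃′_k(U)(δ_x u)‖_{c₁} ≤ √c₁·(L^{n+1})^{−d}·‖u‖`** (`B9Eq319QprimeContraction`'s scaled `ℓ¹` contraction on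
the one-site function). [cite: Balaban1985BackgroundPropagators, (3.19) p.393, (3.11) p.392] -/
theorem norm_QtildeTower_single_le (x : TSite d (towerP L m (n + 1))) (u : W) :
    ‖((WL2.linearEquiv ℂ ℂ (fun _ : TSite d m => c₁)).symm.toLinearMap ∘ₗ QprimeTowerW L m n φ U)
        ((WL2.equiv ℂ (fun _ : TSite d (towerP L m (n + 1)) => c₀) W).symm (Pi.single x u))‖ ≤
      Real.sqrt c₁ * (((L : ℝ) ^ (n + 1)) ^ d)⁻¹ * ‖u‖ := by
  have hc₁ : 0 < c₁ := Fact.out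
  have hL0 : (0 : ℝ) < L := by exact_mod_cast Nat.pos_of_ne_zero (NeZero.ne L)
  refine (pow_le_pow_iff_left₀ (norm_nonneg _) (by positivity) two_ne_zero).1 ?_
  have hsq : ‖((WL2.linearEquiv ℂ ℂ (fun _ : TSite d m => c₁)).symm.toLinearMap ∘ₗ QprimeTowerW L m n φ U)
        ((WL2.equiv ℂ (fun _ : TSite d (towerP L m (n + 1)) => c₀) W).symm (Pi.single x u))‖ ^ 2 =
      c₁ * ∑ y, ‖QprimeTower L m (fun j => adTransportW φ (UlevOf L m (n + 1) U j)) (n + 1) (Pi.single x u) y‖ ^ 2 := by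
    rw [WL2.norm_sq (𝕜 := ℂ) (w := fun _ : TSite d m => c₁) (V := W), Finset.mul_sum]
    refine Finset.sum_congr rfl fun y _ => ?_
    simp only [LinearMap.comp_apply, LinearEquiv.coe_coe, WL2.linearEquiv_symm_apply, Equiv.apply_symm_apply]
    rfl
  rw [hsq, mul_assoc, mul_pow, Real.sq_sqrt hc₁.le]
  refine mul_le_mul_of_nonneg_left ?_ hc₁.le
  have h1 : ∑ y, ‖QprimeTower L m (fun j => adTransportW φ (UlevOf L m (n + 1) U j)) (n + 1) (Pi.single x u) y‖ ^ 2 ≤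
      (∑ y, ‖QprimeTower L m (fun j => adTransportW φ (UlevOf L m (n + 1) U j)) (n + 1) (Pi.single x u) y‖) ^ 2 :=
    Finset.sum_sq_le_sq_sum_of_nonneg fun y _ => norm_nonneg _
  have h2 : ∑ y, ‖QprimeTower L m (fun j => adTransportW φ (UlevOf L m (n + 1) U j)) (n + 1) (Pi.single x u) y‖ ≤
      (((L : ℝ) ^ (n + 1)) ^ d)⁻¹ * ‖u‖ := by
    have h := sum_norm_QprimeTower_le L m (fun j => adTransportW φ (UlevOf L m (n + 1) U j)) hRlev (n + 1) (Pi.single x u)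
    rwa [sum_norm_single_apply] at h
  exact h1.trans (pow_le_pow_left₀ (Finset.sum_nonneg fun y _ => norm_nonneg _) h2 2)

omit hRlev in
/-- The penalty of the `k`-level (3.24) IS `a′·Q̃′_k(U)†Q̃′_k(U)` (definitional bookkeeping on `laplacePrimeAk`). [cite: Balaban1985BackgroundPropagators, (3.24) p.394] -/
theorem laplacePrimeAk_sub_covLaplace_eq (η a' : ℝ) (v : SiteL2K ℂ d (towerP L m (n + 1)) c₀ W) [FiniteDimensional ℂ W] :
    laplacePrimeAk L m n φ η U a' (c₁ := c₁) v -
        covLaplaceSiteK ((η : ℂ))⁻¹ (adTransportW φ U) (adTransportW φ fun b => (U b)⁻¹) v =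
      (a' : ℂ) • LinearMap.adjoint ((WL2.linearEquiv ℂ ℂ (fun _ : TSite d m => c₁)).symm.toLinearMap ∘ₗ QprimeTowerW L m n φ U)
        (((WL2.linearEquiv ℂ ℂ (fun _ : TSite d m => c₁)).symm.toLinearMap ∘ₗ QprimeTowerW L m n φ U) v) := by
  simp only [laplacePrimeAk, LinearMap.add_apply, LinearMap.smul_apply, LinearMap.comp_apply, add_sub_cancel_left]

variable [FiniteDimensional ℂ W]

/-- **THE ADJOINT `Q̃′_k(U)†` POINTWISE: `‖(Q̃′_k(U)†h)(x)‖ ≤ (√c₁∕(c₀(L^{n+1})^d))·‖h‖_{c₁}`** at every site of `T_{L^{n+1}m}` (§0 at the one-site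
image); `1∕√c₁` on the diagonal. [cite: Balaban1985BackgroundPropagators, (3.19) p.393, (3.24) p.394, (3.11) p.392] -/
theorem norm_adjoint_QtildeTower_apply_le (h : SiteL2K ℂ d m c₁ W) (x : TSite d (towerP L m (n + 1))) :
    ‖WL2.equiv ℂ (fun _ : TSite d (towerP L m (n + 1)) => c₀) W
        (LinearMap.adjoint ((WL2.linearEquiv ℂ ℂ (fun _ : TSite d m => c₁)).symm.toLinearMap ∘ₗ QprimeTowerW L m n φ U) h) x‖ ≤
      Real.sqrt c₁ * (((L : ℝ) ^ (n + 1)) ^ d)⁻¹ / c₀ * ‖h‖ :=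
  norm_adjoint_apply_le (𝕜 := ℂ) (w := fun _ : TSite d (towerP L m (n + 1)) => c₀) _ x (by positivity)
    (fun u => norm_QtildeTower_single_le L m n φ U hRlev x u) h

/-- **THE PENALTY LETTER (P) OF THE SUP-NORM BOOTSTRAP AT `k = n+1` LEVELS, INHABITED FOR CONTRACTIVE LEVEL TRANSPORTERS**:
`‖((Δ′_{a′,k}(U) − Δ^η_U)v)(x)‖ ≤ |a′|·(c₁∕(c₀(L^{n+1})^d))·(c₀(L^{n+1})^d)^{−1∕2}·‖v‖_{c₀}` at every site of `T_{L^{n+1}m}`, EVERY `n` — LITERALLY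
the binder `hP` of the NE9 owner's `B9Eq342GreenPrimeTowerSupBound.norm_GpOfUk_apply_le` at `p₂ := |a′|·(c₁∕(c₀(L^{n+1})^d))·(√(c₀(L^{n+1})^d))⁻¹`;
LEVEL-FREE on the diagonal (next theorem). [cite: Balaban1985BackgroundPropagators, (3.24) p.394, Thm 3.1 (3.42) p.397] -/
theorem norm_laplacePrimeAk_sub_covLaplace_apply_le (η a' : ℝ) (v : SiteL2K ℂ d (towerP L m (n + 1)) c₀ W)
    (x : TSite d (towerP L m (n + 1))) :
    ‖WL2.equiv ℂ _ W (laplacePrimeAk L m n φ η U a' (c₁ := c₁) v -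
        covLaplaceSiteK ((η : ℂ))⁻¹ (adTransportW φ U) (adTransportW φ fun b => (U b)⁻¹) v) x‖ ≤
      |a'| * (c₁ / (c₀ * ((L : ℝ) ^ (n + 1)) ^ d)) * (Real.sqrt (c₀ * ((L : ℝ) ^ (n + 1)) ^ d))⁻¹ * ‖v‖ := by
  have hc₀ : 0 < c₀ := Fact.out
  have hc₁ : 0 < c₁ := Fact.out
  have hLr : (0 : ℝ) < ((L : ℝ) ^ (n + 1)) ^ d := pow_pos (pow_pos (by exact_mod_cast Nat.pos_of_ne_zero (NeZero.ne L)) _) d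
  rw [laplacePrimeAk_sub_covLaplace_eq L m n φ U (c₁ := c₁) η a' v, WL2.equiv_smul, Pi.smul_apply, norm_smul, Complex.norm_real,
    Real.norm_eq_abs]
  have h1 := norm_adjoint_QtildeTower_apply_le L m n φ (c₀ := c₀) U hRlev
    (((WL2.linearEquiv ℂ ℂ (fun _ : TSite d m => c₁)).symm.toLinearMap ∘ₗ QprimeTowerW L m n φ U) v) x
  have h3 := h1.trans (mul_le_mul_of_nonneg_left (norm_QtildeTower_le L m n φ U hRlev (c₁ := c₁) v) (by positivity))
  refine (mul_le_mul_of_nonneg_left h3 (abs_nonneg _)).trans (le_of_eq ?_)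
  rw [← mul_assoc (Real.sqrt c₁ * _ / c₀), penalty_const_eq hc₀ hc₁ hLr]
  ring

/-- **(P) AT `k` LEVELS ON THE DIAGONAL `c₀(L^{n+1})^d = c₁`** (print's point `ηL^{n+1} = 1`, `c₀ = η^d`): `p₂ = |a′|∕√c₁` for EVERY `n` —
LEVEL-FREE and volume-free; with the one-block mass `μ = c₁`, `p₂·√μ = |a′|`. [cite: Balaban1985BackgroundPropagators, (3.24) p.394, Thm 3.1 (3.42) p.397] -/
theorem norm_laplacePrimeAk_sub_covLaplace_apply_le_diagonal (hw : c₀ * ((L : ℝ) ^ (n + 1)) ^ d = c₁) (η a' : ℝ)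
    (v : SiteL2K ℂ d (towerP L m (n + 1)) c₀ W) (x : TSite d (towerP L m (n + 1))) :
    ‖WL2.equiv ℂ _ W (laplacePrimeAk L m n φ η U a' (c₁ := c₁) v -
        covLaplaceSiteK ((η : ℂ))⁻¹ (adTransportW φ U) (adTransportW φ fun b => (U b)⁻¹) v) x‖ ≤
      |a'| * (Real.sqrt c₁)⁻¹ * ‖v‖ := by
  have hc₁ : 0 < c₁ := Fact.out
  have h := norm_laplacePrimeAk_sub_covLaplace_apply_le L m n φ U hRlev (c₁ := c₁) η a' v x
  have h1 : c₁ / (c₀ * ((L : ℝ) ^ (n + 1)) ^ d) = 1 := by rw [hw]; exact div_self hc₁.ne'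
  rwa [h1, mul_one, hw] at h

end ChainTower

end Literature.MathematicalPhysics.QuantumFieldTheory.Balaban1983to89.B9Eq324PenaltyPointwiseBound

end
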